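import Literature.Computability.AlgebraicComplexity.SlidingWindowPolynomial
import HarnessLib

/-!
# Derivatives of the restricted sliding-window polynomial (support structure)

Topic `Literature/Computability/AlgebraicComplexity`; sequel of `SlidingWindowPolynomial.lean`,
part of the discharge of `Literature.Barriers.ValiantsHypothesis.DepthReductionChasmDepthFour`
(Kumar–Saraf 2017, Cor. 1.3) by the sliding-window witness. For a copy selector `g` the
restricted polynomial is `P = swPoly|_{selVars g} = ∑_z x^{E_g(z)}` (`restrictVars_swPoly`).
We fix `r` SITES `site : Fin r → Fin n` (injective) and, for every choice
`wv : Fin r → Win t` of window contents at the sites, the order-`r` derivative operator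
`∂_{wv}` along the variables `sv wv i = x_{site i, wv i, g (site i) (wv i)}` — the analogue of
Kumar–Saraf's set of monomials `𝒯` (§8.4). Results (all proved):

* `iterPderiv_restrict` — `∂_{wv} P = ∑_{z ∈ Zset wv} x^{NS(z)}`, the sum over the strings whose
  site windows are `wv` of the monomials on their NON-SITE variables `NS(z)`;
* `support_iterPderiv_restrict` — its support is `{x^{NS(z)} : z ∈ Zset wv}` (distinct
  monomials, `nsVars_injOn`), all multilinear of support size `n - r`;
* `card_union_nsVars`, `card_sdiff_nsVars` — for `z ∈ Zset wv`, `z' ∈ Zset wv'`: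
  `|NS(z) ∪ NS(z')| = 2(n-r) - agr(z,z')`, `|NS(z') ∖ NS(z)| = (n-r) - agr(z,z')`, where
  `agr(z, z')` is the number of non-site layers at which the windows of `z` and `z'` agree — the
  distances `Δ(β, γ)` of Kumar–Saraf §8.5 in this model.

## References

* M. Kumar, S. Saraf, *On the power of homogeneous depth 4 arithmetic circuits*, SIAM J. Comput.
  46 (2017) 336–387: §8.4 (the derivatives), §8.5 (`T₁, T₂, T₃`, distances).
-/

noncomputable section

open MvPolynomial

namespace Literature.Computability.AlgebraicComplexity

namespace SlidingWindow

open KumarSaraf GKKS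

variable {n t B r : ℕ} (g : Fin n → Win t → Fin (B + 1)) (site : Fin r → Fin n)

/-! ### Sites, derivative variables, non-site variables -/

/-- The derivative variable at site `i` for the window contents `wv`:
`x_{site i, wv i, g (site i) (wv i)}`. [cite: KumarSaraf2017, §8.4] -/
def sv (wv : Fin r → Win t) (i : Fin r) : Var n t B := ⟨site i, (wv i, g (site i) (wv i))⟩

/-- The order-`r` derivative operator `∂_{wv}` as a list of variables. [cite: KumarSaraf2017, §8.4] -/
def Ls (wv : Fin r → Win t) : List (Var n t B) := List.ofFn (sv g site wv)

/-- The set of derivative variables `A(wv)`. [cite: KumarSaraf2017, §8.4] -/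
def Avars (wv : Fin r → Win t) : Finset (Var n t B) := Finset.univ.image (sv g site wv)

/-- The strings whose site windows are `wv`. [cite: KumarSaraf2017, §8.4] -/
def Zset (wv : Fin r → Win t) : Finset (List.Vector Bool (n + t)) :=
  Finset.univ.filter fun z => ∀ i, win z (site i) = wv i

/-- The non-site layers. [folklore] -/
def nonSites : Finset (Fin n) := Finset.univ.filter fun ℓ => ℓ ∉ Set.range site

/-- The **non-site variables** `NS(z)` of a string: `x_{ℓ, z[ℓ..ℓ+t], g …}` for `ℓ` not a site.
[cite: KumarSaraf2017, §8.5] -/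
def nsVars (z : List.Vector Bool (n + t)) : Finset (Var n t B) := (nonSites site).image (varOf g z)

/-- The **agreement** of two strings: the number of non-site layers with equal windows
(`|β ∩ β'|` for their non-site monomials; `Δ = (n - r) - agr`). [cite: KumarSaraf2017, §8.5] -/
def agr (z z' : List.Vector Bool (n + t)) : ℕ :=
  ((nonSites site).filter fun ℓ => win z ℓ = win z' ℓ).card

variable {g site}

/-- The length of `Ls`. [cite: KumarSaraf2017, §8.4] -/
@[simp] theorem length_Ls (wv : Fin r → Win t) : (Ls g site wv).length = r := by simp [Ls]

/-- Membership in `Zset`. [cite: KumarSaraf2017, §8.4] -/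
@[simp] theorem mem_Zset {wv : Fin r → Win t} {z : List.Vector Bool (n + t)} :
    z ∈ Zset site wv ↔ ∀ i, win z (site i) = wv i := by simp [Zset]

/-- Membership in `nonSites`. [folklore] -/
@[simp] theorem mem_nonSites {ℓ : Fin n} : ℓ ∈ nonSites site ↔ ∀ i, site i ≠ ℓ := by
  simp [nonSites]

variable (hsite : Function.Injective site)
include hsite

/-- `sv wv` is injective in the site. [cite: KumarSaraf2017, §8.4] -/
theorem sv_injective (wv : Fin r → Win t) : Function.Injective (sv g site wv) :=
  fun _ _ h => hsite (congrArg Sigma.fst h)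

/-- `Ls wv` has no duplicates. [cite: KumarSaraf2017, §8.4] -/
theorem nodup_Ls (wv : Fin r → Win t) : (Ls g site wv).Nodup := by
  rw [Ls, List.nodup_ofFn]; exact sv_injective hsite wv

/-- `|A(wv)| = r`. [cite: KumarSaraf2017, §8.4] -/
theorem card_Avars (wv : Fin r → Win t) : (Avars g site wv).card = r := by
  rw [Avars, Finset.card_image_of_injective _ (sv_injective hsite wv), Finset.card_univ,
    Fintype.card_fin]

/-- The number of non-site layers is `n - r`. [folklore] -/
theorem card_nonSites : (nonSites site).card = n - r := by
  classical
  have h : nonSites site = Finset.univ \ Finset.univ.image site := by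
    ext ℓ; simp [nonSites, eq_comm]
  rw [h, Finset.card_univ_sdiff, Finset.card_image_of_injective _ hsite, Finset.card_univ,
    Fintype.card_fin, Fintype.card_fin]

omit hsite in
/-- `|NS(z)| = |non-sites|`. [cite: KumarSaraf2017, §8.5] -/
theorem card_nsVars (z : List.Vector Bool (n + t)) : (nsVars g site z).card = (nonSites site).card :=
  Finset.card_image_of_injective _ (varOf_injective g z)

omit hsite in
/-- When do two string variables coincide: same layer and same window. [folklore] -/
theorem varOf_eq_varOf_iff {z z' : List.Vector Bool (n + t)} {ℓ ℓ' : Fin n} :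
    varOf g z ℓ = varOf g z' ℓ' ↔ ℓ = ℓ' ∧ win z ℓ = win z' ℓ := by
  constructor
  · intro h
    have h1 : ℓ = ℓ' := congrArg Sigma.fst h
    subst h1
    refine ⟨rfl, ?_⟩
    have h2 := congrArg (fun v : Var n t B => v.2.1) h
    exact h2
  · rintro ⟨rfl, hw⟩
    simp [varOf, hw]

omit hsite in
/-- Membership of a derivative variable in `E_g(z)`: the site window of `z` is prescribed.
[cite: KumarSaraf2017, §8.4] -/
theorem sv_mem_Ez_iff {wv : Fin r → Win t} {z : List.Vector Bool (n + t)} {i : Fin r} :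
    sv g site wv i ∈ Ez g z ↔ win z (site i) = wv i := by
  rw [mem_Ez]
  constructor
  · rintro ⟨ℓ, hℓ⟩
    have h1 : ℓ = site i := congrArg Sigma.fst hℓ
    subst h1
    have h2 := congrArg (fun v : Var n t B => v.2.1) hℓ
    exact h2
  · intro hw
    exact ⟨site i, by simp [varOf, sv, hw]⟩

omit hsite in
/-- For `z ∈ Zset wv`, the derivative variables lie in `E_g(z)`. [cite: KumarSaraf2017, §8.4] -/
theorem Avars_subset_Ez {wv : Fin r → Win t} {z : List.Vector Bool (n + t)} (hz : z ∈ Zset site wv) :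
    Avars g site wv ⊆ Ez g z := by
  intro v hv
  rw [Avars, Finset.mem_image] at hv
  obtain ⟨i, -, rfl⟩ := hv
  exact sv_mem_Ez_iff.2 (mem_Zset.1 hz i)

omit hsite in
/-- **`E_g(z) ∖ A(wv) = NS(z)`** for `z ∈ Zset wv`. [cite: KumarSaraf2017, §8.5] -/
theorem Ez_sdiff_Avars {wv : Fin r → Win t} {z : List.Vector Bool (n + t)} (hz : z ∈ Zset site wv) :
    Ez g z \ Avars g site wv = nsVars g site z := by
  ext v
  rw [Finset.mem_sdiff, mem_Ez, nsVars, Finset.mem_image]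
  constructor
  · rintro ⟨⟨ℓ, rfl⟩, hnot⟩
    refine ⟨ℓ, mem_nonSites.2 fun i hi => hnot ?_, rfl⟩
    rw [Avars, Finset.mem_image]
    refine ⟨i, Finset.mem_univ _, ?_⟩
    subst hi
    simp [sv, varOf, mem_Zset.1 hz i]
  · rintro ⟨ℓ, hℓ, rfl⟩
    refine ⟨⟨ℓ, rfl⟩, fun hA => ?_⟩
    rw [Avars, Finset.mem_image] at hA
    obtain ⟨i, -, hi⟩ := hA
    exact (mem_nonSites.1 hℓ) i (congrArg Sigma.fst hi)

/-! ### The derivative `∂_{wv} P` -/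

omit hsite in
/-- The indicator of the derivative list is `chi (A wv)`. [cite: KumarSaraf2017, §8.4] -/
theorem listInd_Ls (hsite : Function.Injective site) (wv : Fin r → Win t) :
    listInd (Ls g site wv) = chi (Avars g site wv) := by
  classical
  rw [Ls, listInd_ofFn, chi, Avars, Finset.sum_image fun _ _ _ _ h => sv_injective hsite wv h]

omit hsite in
/-- `chi E - chi A = chi (E ∖ A)` for `A ⊆ E`. [folklore] -/
theorem chi_sub_chi {σ : Type*} [DecidableEq σ] {A E : Finset σ} (h : A ⊆ E) :
    chi E - chi A = chi (E \ A) := by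
  ext v
  simp only [Finsupp.tsub_apply, chi_apply, Finset.mem_sdiff]
  by_cases hE : v ∈ E
  · by_cases hA : v ∈ A <;> simp [hE, hA]
  · have hA : v ∉ A := fun hA => hE (h hA)
    simp [hE, hA]

omit hsite in
/-- Indicator vectors are injective in the set (a `KumarSaraf.chi` API lemma). [folklore] -/
theorem _root_.Literature.Computability.AlgebraicComplexity.KumarSaraf.chi_injective
    {σ : Type*} : Function.Injective (chi : Finset σ → σ →₀ ℕ) := fun S T h => by
  have := congrArg Finsupp.support h
  rwa [support_chi, support_chi] at this

variable {K : Type*} [Field K]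

/-- **The derivative of one string monomial**: `∂_{wv} x^{E_g(z)}` is `x^{NS(z)}` if the site
windows of `z` are `wv` and `0` otherwise. [cite: KumarSaraf2017, §8.4] -/
theorem iterPderiv_monomial_Ez (wv : Fin r → Win t) (z : List.Vector Bool (n + t)) :
    iterPderiv (Ls g site wv) (monomial (chi (Ez g z)) (1 : K)) =
      if z ∈ Zset site wv then monomial (chi (nsVars g site z)) 1 else 0 := by
  classical
  rw [iterPderiv_monomial _ (nodup_Ls hsite wv), one_mul, listInd_Ls hsite]
  have hprod : ((Ls g site wv).map fun v => ((chi (Ez g z)) v : K)).prod =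
      if (∀ i, win z (site i) = wv i) then 1 else 0 := by
    rw [Ls, List.map_ofFn, List.prod_ofFn]
    simp only [Function.comp_def, chi_apply, sv_mem_Ez_iff]
    push_cast
    rw [Fintype.prod_boole]
    split_ifs <;> rfl
  rw [hprod]
  by_cases hz : z ∈ Zset site wv
  · rw [if_pos (mem_Zset.1 hz), if_pos hz, chi_sub_chi (Avars_subset_Ez hz), Ez_sdiff_Avars hz]
  · rw [if_neg (fun h => hz (mem_Zset.2 h)), if_neg hz]
    exact map_zero _

/-- **`∂_{wv} P = ∑_{z ∈ Zset wv} x^{NS(z)}`** for `P = swPoly|_{selVars g}` (`0 < n`).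
[cite: KumarSaraf2017, §8.4] -/
theorem iterPderiv_restrict (hn : 0 < n) (wv : Fin r → Win t) :
    iterPderiv (Ls g site wv) (restrictVars (selVars g) (swPoly K n t B)) =
      ∑ z ∈ Zset site wv, monomial (chi (nsVars g site z)) (1 : K) := by
  classical
  rw [restrictVars_swPoly K hn g, map_sum]
  simp_rw [iterPderiv_monomial_Ez hsite]
  rw [Finset.sum_ite, Finset.sum_const_zero, add_zero, Finset.filter_mem_eq_inter,
    Finset.univ_inter]

omit hsite in
/-- **The non-site variables determine the string** on `Zset wv`. [folklore] -/
theorem nsVars_injOn (hn : 0 < n) (wv : Fin r → Win t) :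
    Set.InjOn (nsVars g site) (Zset site wv : Set (List.Vector Bool (n + t))) := by
  intro z hz z' hz' h
  rw [Finset.mem_coe] at hz hz'
  apply List.Vector.eq
  refine ext_of_winL_eq hn z.toList_length z'.toList_length fun ℓ hℓ => ?_
  change (win z ⟨ℓ, hℓ⟩).toList = (win z' ⟨ℓ, hℓ⟩).toList
  congr 1
  by_cases hs : (⟨ℓ, hℓ⟩ : Fin n) ∈ nonSites site
  · have hv : varOf g z ⟨ℓ, hℓ⟩ ∈ nsVars g site z' := by
      rw [← h, nsVars]; exact Finset.mem_image_of_mem _ hs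
    rw [nsVars, Finset.mem_image] at hv
    obtain ⟨ℓ', -, hℓ'⟩ := hv
    obtain ⟨h1, h2⟩ := varOf_eq_varOf_iff.1 hℓ'
    subst h1
    exact h2.symm
  · rw [mem_nonSites] at hs
    push Not at hs
    obtain ⟨i, hi⟩ := hs
    rw [← hi, mem_Zset.1 hz i, mem_Zset.1 hz' i]

omit hsite in
/-- Coefficients of a sum of distinct monic monomials. [folklore] -/
theorem coeff_sum_monomial_one_of_injOn {ι σ : Type*} [DecidableEq ι] [DecidableEq σ]
    (S : Finset ι) (φ : ι → σ →₀ ℕ) (hφ : Set.InjOn φ S) (d : σ →₀ ℕ) :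
    coeff d (∑ i ∈ S, monomial (φ i) (1 : K)) = if d ∈ S.image φ then 1 else 0 := by
  rw [coeff_sum]
  simp_rw [coeff_monomial]
  rw [Finset.sum_boole]
  split_ifs with h
  · rw [Finset.mem_image] at h
    obtain ⟨i, hi, rfl⟩ := h
    have : (S.filter fun j => φ j = φ i) = {i} := by
      refine Finset.eq_singleton_iff_unique_mem.2 ⟨Finset.mem_filter.2 ⟨hi, rfl⟩, fun j hj => ?_⟩
      rw [Finset.mem_filter] at hj
      exact hφ hj.1 hi hj.2
    rw [this, Finset.card_singleton, Nat.cast_one]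
  · have : (S.filter fun j => φ j = d) = ∅ := by
      refine Finset.filter_eq_empty_iff.2 fun i hi hEq => h ?_
      exact Finset.mem_image.2 ⟨i, hi, hEq⟩
    rw [this, Finset.card_empty, Nat.cast_zero]

/-- **The support of `∂_{wv} P`**: the monomials `x^{NS(z)}`, `z ∈ Zset wv` (`0 < n`).
[cite: KumarSaraf2017, §8.5] -/
theorem support_iterPderiv_restrict (hn : 0 < n) (wv : Fin r → Win t) :
    (iterPderiv (Ls g site wv) (restrictVars (selVars g) (swPoly K n t B))).support =
      (Zset site wv).image fun z => chi (nsVars g site z) := by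
  classical
  have hinj : Set.InjOn (fun z => chi (nsVars g site z)) (Zset site wv : Set _) :=
    fun z hz z' hz' h => nsVars_injOn hn wv hz hz' (chi_injective h)
  ext d
  rw [mem_support_iff, iterPderiv_restrict hsite hn, coeff_sum_monomial_one_of_injOn _ _ hinj]
  split_ifs with h <;> simp [h]

/-- Every monomial of `∂_{wv} P` is multilinear. [cite: KumarSaraf2017, §8.5] -/
theorem isML_of_mem_support (hn : 0 < n) (wv : Fin r → Win t) {β : Var n t B →₀ ℕ}
    (hβ : β ∈ (iterPderiv (Ls g site wv) (restrictVars (selVars g) (swPoly K n t B))).support) :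
    IsML β := by
  rw [support_iterPderiv_restrict hsite hn, Finset.mem_image] at hβ
  obtain ⟨z, -, rfl⟩ := hβ
  exact isML_chi _

/-- Every monomial of `∂_{wv} P` has support size `n - r`. [cite: KumarSaraf2017, §8.5] -/
theorem card_support_of_mem_support (hn : 0 < n) (wv : Fin r → Win t) {β : Var n t B →₀ ℕ}
    (hβ : β ∈ (iterPderiv (Ls g site wv) (restrictVars (selVars g) (swPoly K n t B))).support) :
    β.support.card = n - r := by
  rw [support_iterPderiv_restrict hsite hn, Finset.mem_image] at hβ
  obtain ⟨z, -, rfl⟩ := hβ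
  rw [support_chi, card_nsVars, card_nonSites hsite]

/-- The total number of monomials of all the derivatives is the number of strings, `2^{n+t}`.
[cite: KumarSaraf2017, §8.5] -/
theorem sum_card_support (hn : 0 < n) :
    ∑ wv : Fin r → Win t,
      (iterPderiv (Ls g site wv) (restrictVars (selVars g) (swPoly K n t B))).support.card =
        2 ^ (n + t) := by
  classical
  have h1 : ∀ wv : Fin r → Win t, (iterPderiv (Ls g site wv)
      (restrictVars (selVars g) (swPoly K n t B))).support.card = (Zset site wv).card := by
    intro wv
    rw [support_iterPderiv_restrict hsite hn, Finset.card_image_of_injOn]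
    exact fun z hz z' hz' h => nsVars_injOn hn wv hz hz' (chi_injective h)
  simp_rw [h1]
  -- the `Zset wv` partition the strings
  have h2 := Finset.card_eq_sum_card_fiberwise (f := fun z : List.Vector Bool (n + t) =>
    fun i => win z (site i)) (s := Finset.univ) (t := Finset.univ) (fun _ _ => Finset.mem_univ _)
  rw [Finset.card_univ, card_vector, Fintype.card_bool] at h2
  rw [h2]
  refine Finset.sum_congr rfl fun wv _ => ?_
  congr 1
  ext z
  simp [Zset, funext_iff]

/-! ### Pairs of monomials -/

omit hsite in
/-- `NS(z) ∩ NS(z')` is indexed by the agreeing non-site layers. [cite: KumarSaraf2017, §8.5] -/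
theorem card_inter_nsVars (z z' : List.Vector Bool (n + t)) :
    (nsVars g site z ∩ nsVars g site z').card = agr site z z' := by
  classical
  rw [agr]
  have h : nsVars g site z ∩ nsVars g site z' =
      ((nonSites site).filter fun ℓ => win z ℓ = win z' ℓ).image (varOf g z) := by
    ext v
    simp only [nsVars, Finset.mem_inter, Finset.mem_image, Finset.mem_filter]
    constructor
    · rintro ⟨⟨ℓ, hℓ, rfl⟩, ⟨ℓ', -, hℓ'⟩⟩
      obtain ⟨h1, h2⟩ := varOf_eq_varOf_iff.1 hℓ'
      subst h1
      exact ⟨ℓ', ⟨hℓ, h2.symm⟩, rfl⟩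
    · rintro ⟨ℓ, ⟨hℓ, hw⟩, rfl⟩
      exact ⟨⟨ℓ, hℓ, rfl⟩, ⟨ℓ, hℓ, (varOf_eq_varOf_iff.2 ⟨rfl, hw.symm⟩)⟩⟩
  rw [h, Finset.card_image_of_injective _ (varOf_injective g z)]

omit hsite in
/-- `agr ≤ n - r` (with `hsite`), stated as `agr ≤ |non-sites|`. [cite: KumarSaraf2017, §8.5] -/
theorem agr_le (z z' : List.Vector Bool (n + t)) : agr site z z' ≤ (nonSites site).card :=
  Finset.card_filter_le _ _

/-- **`|NS(z) ∪ NS(z')| = 2(n - r) - agr(z, z')`.** [cite: KumarSaraf2017, §8.5] -/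
theorem card_union_nsVars (z z' : List.Vector Bool (n + t)) :
    (nsVars g site z ∪ nsVars g site z').card = 2 * (n - r) - agr site z z' := by
  have h := Finset.card_union_add_card_inter (nsVars g site z) (nsVars g site z')
  rw [card_inter_nsVars, card_nsVars, card_nsVars, card_nonSites hsite] at h
  have := agr_le (site := site) z z'
  rw [card_nonSites hsite] at this
  omega

/-- **`|NS(z') ∖ NS(z)| = (n - r) - agr(z, z')`.** [cite: KumarSaraf2017, §8.5] -/
theorem card_sdiff_nsVars (z z' : List.Vector Bool (n + t)) :
    (nsVars g site z' \ nsVars g site z).card = (n - r) - agr site z z' := by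
  classical
  have h := Finset.card_sdiff_add_card_inter (nsVars g site z') (nsVars g site z)
  rw [Finset.inter_comm, card_inter_nsVars, card_nsVars, card_nonSites hsite] at h
  omega

end SlidingWindow

end Literature.Computability.AlgebraicComplexity
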